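import Literature.NumberTheory.EllipticCurves.CofreeContinuousRep
import Literature.NumberTheory.EllipticCurves.GreenbergSelmerNewformDatum
import HarnessLib

/-!
# `A_g = V_g/T_g` and `M_g = T_g ⊗_𝒪 Λ_𝒪^*(Ψ⁻¹)` for an ordinary newform datum: the cofree module of
# `ρ_g : Γ_ℚ → GL₂(𝒪)` IS a discrete `Γ_ℚ`-module (the open-denominator hypothesis discharged for
# `𝒪 ⊂ K = ℚ_p(ι(K_g))`), and the `g`-instance of the big anticyclotomic representation

Cell `bsd-stepL` (crux `stmt-BirchSwinnertonDyer-19270`, Road FF): sequel of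
`CofreeContinuousRep.lean` (`cofreeContinuousRep F ρ h` under `HasOpenDenominators 𝒪 F`). Here the
hypothesis is PROVED for the tree's coefficient pair of a newform, `𝒪 = padicCoeffIntegers ι ⊂
F = padicCoeffField ι = ℚ_p(ι(K_g)) ⊂ ℚ̄_p` (`GreenbergSelmerNewformDatum`): the denominator of
`x ∈ F` is `p^k` with `‖x‖ ≤ p^k`, and `p^k 𝒪 = {z : ‖z‖ ≤ p^{-k}}` is an (ultrametric, hence open)
closed ball. Then, for `Δ : OrdinaryNewformDatum g p ι` (integral model `Δ.ρ : Γ_ℚ → GL₂(𝒪)`):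
**`Δ.cofreeRep`** = `A_g = F²/𝒪² = V_g/T_g` as a `ContinuousRep Γ_ℚ 𝒪`, and for a number field `K`
with a `ℤ_p`-extension `κ`, **`Δ.bigRep K κ`** = `M_g = T_g ⊗_𝒪 Λ_𝒪^*(Ψ⁻¹)` =
`AnticyclotomicBigGaloisRep κ (A_g|_{Γ_K})` over `Λ_𝒪 = 𝒪⟦T⟧` — the `g`-side input (`ρg`, with
`BigGaloisRep.selmerBig`/`XBig` its Selmer group and dual `X^Σ_ac(A_g)`) of the kernel glue of crux
19270, on the same footing as `M_f` (`WeierstrassCurve.anticyclotomicBigRep`). Definitions with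
bodies and proved theorems; no named fact, no `sorry`, no instance.

References: [Castella2018Erratum] §2 (p. 2: "`g ∈ S_k(Γ₀(M))` a `p`-ordinary newform … defined over
`𝒪` … `T_g ⊂ V_g` … `A_g := V_g/T_g` … `M_g := T_g ⊗_𝒪 Λ_𝒪^*`, where `G_K` acts on `Λ_𝒪^*` via
`Ψ⁻¹`"); [EmertonPollackWeston2006] §3.1 (`K`, `𝒪`, `A_f = K/𝒪 ⊗ T_f`); [Serre1968] Ch. I §1.1.
-/

noncomputable section

open Field Topology Filter CongruenceSubgroup
open Literature.NumberTheory.GaloisRepresentations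
open Literature.NumberTheory.EllipticCurves.ModularForms
open scoped MatrixGroups ModularForm

namespace Literature.NumberTheory.EllipticCurves.GreenbergSelmer

variable {M : ℕ} {k : ℤ} {g : CuspForm (Gamma0 M) k} {p : ℕ} [Fact p.Prime]
  (ι : coeffField g →+* PadicAlgCl p)

/-- `‖p‖ = p⁻¹` in `ℚ̄_p` (Mathlib `PadicAlgCl.valuation_p`). [folklore] -/
private theorem norm_natCast_p : ‖(p : PadicAlgCl p)‖ = (p : ℝ)⁻¹ := by
  have h := PadicAlgCl.valuation_p p
  rw [PadicAlgCl.valuation_def] at h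
  have : (‖(p : PadicAlgCl p)‖₊ : ℝ) = ((1 / (p : NNReal) : NNReal) : ℝ) := by rw [h]
  simpa using this

/-- **The coefficient pair `(𝒪, K) = (padicCoeffIntegers ι, padicCoeffField ι)` of a newform has
open denominators**: every `x ∈ K = ℚ_p(ι(K_g))` satisfies `p^k x ∈ 𝒪` for `‖x‖ < p^k`, and
`p^k 𝒪 = {z ∈ 𝒪 : ‖z‖ ≤ p^{-k}}` (a `z` of norm `≤ p^{-k}` is `p^k · (z/p^k)` with `z/p^k ∈ 𝒪`) is
the trace on `𝒪` of a closed ball of `ℚ̄_p`, open since `ℚ̄_p` is ultrametric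
(`IsUltrametricDist.isOpen_closedBall`). [cite: EmertonPollackWeston2006, §3.1 (p. 17, "`K` the finite extension of `ℚ_p` generated by the Fourier coefficients … `𝒪` the ring of integers of `K`")]
[cite: Serre1968, Ch. I §1.1 (the `ℓ`-adic topology)] -/
theorem hasOpenDenominators_padicCoeffIntegers :
    HasOpenDenominators (padicCoeffIntegers ι) (padicCoeffField ι) := by
  intro x
  have hp0 : (0 : ℝ) < p := by exact_mod_cast (Fact.out : p.Prime).pos
  have hp1 : (1 : ℝ) < p := by exact_mod_cast (Fact.out : p.Prime).one_lt
  have hnp : ‖(p : PadicAlgCl p)‖ = (p : ℝ)⁻¹ := norm_natCast_p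
  have hnpk : ∀ k : ℕ, ‖((((p : padicCoeffField ι) ^ k : padicCoeffField ι)) : PadicAlgCl p)‖ =
      ((p : ℝ) ^ k)⁻¹ := fun k => by
    push_cast
    rw [norm_pow, hnp, inv_pow]
  obtain ⟨k, hk⟩ := pow_unbounded_of_one_lt ‖(x : PadicAlgCl p)‖ hp1
  have hpk0 : (0 : ℝ) < (p : ℝ) ^ k := pow_pos hp0 k
  have hpkK : ((p : padicCoeffField ι) ^ k) ≠ 0 := pow_ne_zero _ (Nat.cast_ne_zero.2 (Fact.out : p.Prime).ne_zero)
  -- `d = p^k ∈ 𝒪`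
  have hd : ((p : padicCoeffField ι) ^ k) ∈ padicCoeffIntegers ι := by
    rw [mem_padicCoeffIntegers_iff, hnpk]
    exact inv_le_one_of_one_le₀ (one_le_pow₀ hp1.le)
  -- `y = p^k x ∈ 𝒪`
  have hy : ((p : padicCoeffField ι) ^ k) * x ∈ padicCoeffIntegers ι := by
    rw [mem_padicCoeffIntegers_iff]
    push_cast
    rw [norm_mul, norm_pow, hnp, inv_pow]
    rw [inv_mul_le_iff₀ hpk0, mul_one]
    exact hk.le
  refine ⟨⟨_, hd⟩, ⟨_, hy⟩, rfl, ?_⟩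
  -- `p^k 𝒪 = {z : ‖z‖ ≤ p^{-k}}` is open
  have hset : ((Ideal.span {(⟨_, hd⟩ : padicCoeffIntegers ι)} : Ideal (padicCoeffIntegers ι)) :
      Set (padicCoeffIntegers ι)) =
      (fun z : padicCoeffIntegers ι => ((z : padicCoeffField ι) : PadicAlgCl p)) ⁻¹'
        Metric.closedBall 0 (((p : ℝ) ^ k)⁻¹) := by
    ext z
    simp only [SetLike.mem_coe, Set.mem_preimage, Metric.mem_closedBall, dist_zero_right]
    constructor
    · intro hz
      obtain ⟨c, rfl⟩ := Ideal.mem_span_singleton'.1 hz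
      push_cast
      rw [norm_mul, norm_pow, hnp, inv_pow]
      exact mul_le_of_le_one_left (inv_nonneg.2 hpk0.le) ((mem_padicCoeffIntegers_iff ι _).1 c.2)
    · intro hz
      -- `c = z / p^k ∈ 𝒪`
      have hc : (z : padicCoeffField ι) * ((p : padicCoeffField ι) ^ k)⁻¹ ∈ padicCoeffIntegers ι := by
        rw [mem_padicCoeffIntegers_iff]
        push_cast
        rw [norm_mul, norm_inv, norm_pow, hnp, inv_pow, inv_inv]
        rwa [← le_div_iff₀ hpk0, one_div]
      refine Ideal.mem_span_singleton'.2 ⟨⟨_, hc⟩, Subtype.ext ?_⟩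
      change (z : padicCoeffField ι) * ((p : padicCoeffField ι) ^ k)⁻¹ * (p : padicCoeffField ι) ^ k = z
      rw [inv_mul_cancel_right₀ hpkK]
  rw [hset]
  exact (IsUltrametricDist.isOpen_closedBall (0 : PadicAlgCl p) (inv_ne_zero hpk0.ne')).preimage
    (continuous_subtype_val.comp continuous_subtype_val)


/-! ### `A_g` and `M_g` for an ordinary newform datum -/

namespace OrdinaryNewformDatum

variable {ι} (Δ : OrdinaryNewformDatum g p ι)

/-- **`A_g = V_g/T_g = K²/𝒪²`** of the integral model `ρ_g = Δ.ρ : Γ_ℚ → GL₂(𝒪)` as a continuous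
`𝒪`-linear representation of `Γ_ℚ` on a discrete module (`cofreeContinuousRep` with the
open-denominator hypothesis discharged by `hasOpenDenominators_padicCoeffIntegers`).
[cite: Castella2018Erratum, §2 (p. 2, "`A_g := V_g/T_g`")] [cite: EmertonPollackWeston2006, §3.1 ("`A_f = K/𝒪 ⊗ T_f`")] -/
abbrev cofreeRep :
    ContinuousRep (absoluteGaloisGroup ℚ) (padicCoeffIntegers ι) (Cofree Δ.ρ (padicCoeffField ι)) :=
  cofreeContinuousRep (padicCoeffField ι) Δ.ρ (hasOpenDenominators_padicCoeffIntegers ι)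

/-- Unfolding: `Δ.cofreeRep σ a = σ • a` (the tree's action on `Cofree Δ.ρ K`).
[cite: EmertonPollackWeston2006, §3.1] -/
theorem cofreeRep_apply (σ : absoluteGaloisGroup ℚ) (a : Cofree Δ.ρ (padicCoeffField ι)) :
    Δ.cofreeRep σ a = σ • a :=
  rfl

/-- **`A_g|_{Γ_K}`** for a number field `K`: restriction along the tree's `absGaloisRestrict ℚ K`.
[cite: Castella2018Erratum, §2 (p. 2, "`ρ̄_g|_{G_K}`")] -/
abbrev cofreeRepOver (K : Type) [Field K] [NumberField K] :
    ContinuousRep (absoluteGaloisGroup K) (padicCoeffIntegers ι) (Cofree Δ.ρ (padicCoeffField ι)) :=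
  Δ.cofreeRep.restrict (absGaloisRestrict ℚ K)

/-- **`M_g = T_g ⊗_𝒪 Λ_𝒪^*(Ψ⁻¹)`** over a `ℤ_p`-extension `κ` of a number field `K` (intended: `K`
imaginary quadratic, `κ` anticyclotomic): the `g`-instance `AnticyclotomicBigGaloisRep κ (A_g|_{Γ_K})`
of the landed co-induced model — smooth `A_g`-valued functions on `ℤ_p`, `(σ·Φ)(x) = ρ_g(σ)Φ(x − κ σ)`,
`Λ_𝒪 = 𝒪⟦T⟧` via `1 + T ↦ γ`. Its Selmer group / dual are `BigGaloisRep.selmerBig κ (Δ.cofreeRepOver K) 𝔭 Σ`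
/ `XBig …` = the erratum's `Sel^Σ_𝔭(K, M_g)` / `X^Σ_ac(A_g)`.
[cite: Castella2018Erratum, §2 (p. 2, "`M_g := T_g ⊗_𝒪 Λ_𝒪^*`, where `G_K` acts on `Λ_𝒪^*` via `Ψ⁻¹`")] -/
abbrev bigRep (K : Type) [Field K] [NumberField K] (κ : ZpExtension K p)
    [TopologicalSpace (PowerSeries (padicCoeffIntegers ι))] :
    ContinuousRep (absoluteGaloisGroup K) (PowerSeries (padicCoeffIntegers ι))
      (BigRepModule (padicCoeffIntegers ι) p (Cofree Δ.ρ (padicCoeffField ι))) :=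
  AnticyclotomicBigGaloisRep κ (Δ.cofreeRepOver K)

/-- A topological generator `γ` of `κ` (`κ γ = 1`) acts on `M_g` by `(γ·Φ)(x) = γ • Φ(x − 1)`
("`1 + T ↦ γ`"). [cite: Castella2018, §2.2 (p. 5, "`1 + T ↦ γ`")] -/
theorem bigRep_apply_of_isTopGenerator (K : Type) [Field K] [NumberField K] (κ : ZpExtension K p)
    [TopologicalSpace (PowerSeries (padicCoeffIntegers ι))] {γ : absoluteGaloisGroup K}
    (hγ : κ.IsTopGenerator γ)
    (Φ : BigRepModule (padicCoeffIntegers ι) p (Cofree Δ.ρ (padicCoeffField ι))) (x : ℤ_[p]) :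
    Δ.bigRep K κ γ Φ x = (Δ.cofreeRepOver K) γ (Φ (x - 1)) :=
  AnticyclotomicBigGaloisRep_apply_of_isTopGenerator κ (Δ.cofreeRepOver K) hγ Φ x

end OrdinaryNewformDatum

end Literature.NumberTheory.EllipticCurves.GreenbergSelmer

end
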